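import Summits.AtomisticToContinuum.Crystallization.Theorems.FrustratedLawDichotomyStrainedPatchHomValueT2SoundB

/-!
# (I1) part G — NEAR-LABEL COMPLETENESS for the G5′ value leaf (`…HomValueT2Kit.nearA / nearB`, the `y = U·q` form): labels rejected by the filters are
# at radius `≥ 9/2` on the whole box (so their `W₄₅` term vanishes identically there), the lists are duplicate-free sublists of `[−7,7]³`, and ★ the two
# `hver` energy sums equal the near-label sums (27623 `(H) HomFloor`, hcp half; decomp-a2c hand-1 g41; FINDING-hand-1-g41 §6 (R6)).

Verbatim analogues of `…HomCurvNear.far_of_not_near` / `…HomCurvNearSplit.boxSum_eq_nearSum` for the new filters (both families; the `A` family carries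
`b ≠ 0`).  No definitions; 0 sorry; standard axioms; no instances / notation / `#eval`.  `--supports stmt-AtomisticToContinuum-27623`.
-/

noncomputable section

namespace Summit.AtomisticToContinuum.Crystallization.Theorems.FrustratedLawDichotomyStrainedPatchHomValueT2Kit

open scoped BigOperators RealInnerProductSpace
open Literature.Analysis.ValidatedNumerics.Numerics
open Summit.AtomisticToContinuum.Crystallization.Theorems.ChargedEnergyGapNegative (E3)
open Summit.AtomisticToContinuum.Crystallization.Theorems.FrustratedLawDichotomySchurCut (effPot w₄₅ ω₄)
open Summit.AtomisticToContinuum.Crystallization.Theorems.FrustratedLawDichotomyStrainedPatchHomSplit (latPt hexFrame hcpShift)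
open Summit.AtomisticToContinuum.Crystallization.Theorems.FrustratedLawDichotomyStrainedPatchHomTermCalculus (effPot45_eq_far)
open Summit.AtomisticToContinuum.Crystallization.Theorems.FrustratedLawDichotomyStrainedPatchHomEntryGram (mem_entryFI)
open Summit.AtomisticToContinuum.Crystallization.Theorems.FrustratedLawDichotomyStrainedPatchHomEntryGramHcp (dot3 shufFI mem_dot3 mem_shufFI)
open Summit.AtomisticToContinuum.Crystallization.Theorems.FrustratedLawDichotomyStrainedPatchHomCurvLeaf
  (boxLabels7 boxLabels7_toFinset boxLabels7_nodup)
open Summit.AtomisticToContinuum.Crystallization.Theorems.FrustratedLawDichotomyStrainedPatchHomCurvCentreKit (boxE)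

/-! ## §1. Bookkeeping -/

/-- `nearB ⊆ boxLabels7`. [formal bookkeeping] -/
theorem mem_boxLabels7_of_mem_nearB {c w : (Fin 3 × Fin 3) ⊕ Fin 3 → ℤ} {b : Fin 3 → ℤ} (h : b ∈ nearB c w) : b ∈ boxLabels7 :=
  (List.mem_filter.1 h).1

/-- `nearA ⊆ boxLabels7`, and its labels are nonzero. [formal bookkeeping] -/
theorem mem_boxLabels7_of_mem_nearA {c w : (Fin 3 × Fin 3) ⊕ Fin 3 → ℤ} {b : Fin 3 → ℤ} (h : b ∈ nearA c w) : b ∈ boxLabels7 ∧ b ≠ 0 := by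
  obtain ⟨h7, ht⟩ := List.mem_filter.1 h
  simp only [Bool.and_eq_true, decide_eq_true_eq] at ht
  refine ⟨h7, fun hb => ?_⟩
  rcases ht.1 with h0 | h1 | h2
  · exact h0 (by simp [hb])
  · exact h1 (by simp [hb])
  · exact h2 (by simp [hb])

/-- `(nearB c w).Nodup`. [formal bookkeeping] -/
theorem nearB_nodup (c w : (Fin 3 × Fin 3) ⊕ Fin 3 → ℤ) : (nearB c w).Nodup := by unfold nearB; exact boxLabels7_nodup.filter _

/-- `(nearA c w).Nodup`. [formal bookkeeping] -/
theorem nearA_nodup (c w : (Fin 3 × Fin 3) ⊕ Fin 3 → ℤ) : (nearA c w).Nodup := by unfold nearA; exact boxLabels7_nodup.filter _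

/-- `farQ.hi ≥ (81/4)·SC`. [arithmetic] -/
theorem farQ_hi : (81 / 4 : ℝ) * SC ≤ (farQ.hi : ℝ) := (FI.mem_ofFrac 81 (q := 4) (by norm_num)).2.trans_eq' (by norm_num)

/-- `(9/2)² ≤ ρ²` ⟹ `9/2 ≤ ρ` (`ρ ≥ 0`). [arithmetic] -/
theorem nineHalf_le_of_sq {ρ : ℝ} (hρ : 0 ≤ ρ) (h : (81 / 4 : ℝ) ≤ ρ ^ 2) : 9 / 2 ≤ ρ := by nlinarith

/-! ## §2. Rejected ⟹ far -/

/-- ★ **`B` family**: `b ∈ boxLabels7 ∖ nearB c w` ⟹ `9/2 ≤ ‖latPt U hexFrame b + U(hcpShift + ξ)‖` for every `(U, ξ)` of the box. [folklore] -/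
theorem farB_of_not_nearB {c w : (Fin 3 × Fin 3) ⊕ Fin 3 → ℤ} {b : Fin 3 → ℤ} (hb7 : b ∈ boxLabels7) (hnot : b ∉ nearB c w) (U : E3 →L[ℝ] E3) (ξ : E3)
    (hbox : ∀ ab : Fin 3 × Fin 3, |(U (EuclideanSpace.single ab.2 (1 : ℝ))) ab.1 - (c (Sum.inl ab) : ℝ) / SC| ≤ (w (Sum.inl ab) : ℝ) / SC)
    (hξ : ∀ i : Fin 3, |ξ i - (c (Sum.inr i) : ℝ) / SC| ≤ (w (Sum.inr i) : ℝ) / SC) :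
    9 / 2 ≤ ‖latPt U hexFrame b + U (hcpShift + ξ)‖ := by
  have hS : (0 : ℝ) < SC := SC_pos
  set y := tab3 (yOf (boxE c w) (tab3 (qB (shufFI c w) b))) with hy
  have htest : ¬ ((dot3 y y).lo < farQ.hi) := by
    intro hlt; apply hnot
    simp only [nearB, List.mem_filter, decide_eq_true_eq]
    exact ⟨hb7, hlt⟩
  rw [not_lt] at htest
  have hC : ∀ a, FI.mem ((latPt U hexFrame b + U (hcpShift + ξ)) a) (y a) :=
    fun a => mem_yOf_B U ξ (fun ab => mem_entryFI (hbox ab)) (fun i => mem_shufFI (hξ i)) b a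
  have hQ : FI.mem (‖latPt U hexFrame b + U (hcpShift + ξ)‖ ^ 2) (dot3 y y) := by
    have := mem_dot3 hC hC; rwa [real_inner_self_eq_norm_sq] at this
  have h2 : ((farQ.hi : ℤ) : ℝ) ≤ ((dot3 y y).lo : ℝ) := by exact_mod_cast htest
  have h3 : ((dot3 y y).lo : ℝ) ≤ ‖latPt U hexFrame b + U (hcpShift + ξ)‖ ^ 2 * SC := hQ.1
  exact nineHalf_le_of_sq (norm_nonneg _) (le_of_mul_le_mul_right (farQ_hi.trans (h2.trans h3)) hS)

/-- ★ **`A` family**: `b ∈ boxLabels7`, `b ≠ 0`, `b ∉ nearA c w` ⟹ `9/2 ≤ ‖latPt U hexFrame b‖` for every `U` of the box. [folklore] -/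
theorem farA_of_not_nearA {c w : (Fin 3 × Fin 3) ⊕ Fin 3 → ℤ} {b : Fin 3 → ℤ} (hb7 : b ∈ boxLabels7) (hb0 : b ≠ 0) (hnot : b ∉ nearA c w)
    (U : E3 →L[ℝ] E3)
    (hbox : ∀ ab : Fin 3 × Fin 3, |(U (EuclideanSpace.single ab.2 (1 : ℝ))) ab.1 - (c (Sum.inl ab) : ℝ) / SC| ≤ (w (Sum.inl ab) : ℝ) / SC) :
    9 / 2 ≤ ‖latPt U hexFrame b‖ := by
  have hS : (0 : ℝ) < SC := SC_pos
  set y := tab3 (yOf (boxE c w) (tab3 (pA b))) with hy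
  have hne : b 0 ≠ 0 ∨ b 1 ≠ 0 ∨ b 2 ≠ 0 := by
    by_contra hall
    push Not at hall
    exact hb0 (funext fun i => by fin_cases i <;> simp [hall.1, hall.2.1, hall.2.2])
  have htest : ¬ ((dot3 y y).lo < farQ.hi) := by
    intro hlt; apply hnot
    simp only [nearA, List.mem_filter, Bool.and_eq_true, decide_eq_true_eq]
    exact ⟨hb7, hne, hlt⟩
  rw [not_lt] at htest
  have hC : ∀ a, FI.mem ((latPt U hexFrame b) a) (y a) := fun a => mem_yOf_A U (fun ab => mem_entryFI (hbox ab)) b a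
  have hQ : FI.mem (‖latPt U hexFrame b‖ ^ 2) (dot3 y y) := by
    have := mem_dot3 hC hC; rwa [real_inner_self_eq_norm_sq] at this
  have h2 : ((farQ.hi : ℤ) : ℝ) ≤ ((dot3 y y).lo : ℝ) := by exact_mod_cast htest
  have h3 : ((dot3 y y).lo : ℝ) ≤ ‖latPt U hexFrame b‖ ^ 2 * SC := hQ.1
  exact nineHalf_le_of_sq (norm_nonneg _) (le_of_mul_le_mul_right (farQ_hi.trans (h2.trans h3)) hS)

/-! ## §3. ★ Box sums = near-label sums -/

/-- ★ **`B` family energy**: the `hver` sum over `[−7,7]³` equals the sum over `(nearB c w).toFinset`. [folklore] -/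
theorem boxSumB_eq_nearSum {c w : (Fin 3 × Fin 3) ⊕ Fin 3 → ℤ} (U : E3 →L[ℝ] E3)
    (hbox : ∀ ab : Fin 3 × Fin 3, |(U (EuclideanSpace.single ab.2 (1 : ℝ))) ab.1 - (c (Sum.inl ab) : ℝ) / SC| ≤ (w (Sum.inl ab) : ℝ) / SC)
    (ξ : E3) (hξ : ∀ i : Fin 3, |ξ i - (c (Sum.inr i) : ℝ) / SC| ≤ (w (Sum.inr i) : ℝ) / SC) :
    ∑ b ∈ (Fintype.piFinset fun _ : Fin 3 => Finset.Icc (-7 : ℤ) 7), effPot w₄₅ ω₄ (3 / 400) ‖latPt U hexFrame b + U (hcpShift + ξ)‖ =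
      ∑ b ∈ (nearB c w).toFinset, effPot w₄₅ ω₄ (3 / 400) ‖latPt U hexFrame b + U (hcpShift + ξ)‖ := by
  classical
  rw [← boxLabels7_toFinset]
  symm
  refine Finset.sum_subset (fun b hb => List.mem_toFinset.2 (mem_boxLabels7_of_mem_nearB (List.mem_toFinset.1 hb))) ?_
  intro b hb hnot
  exact effPot45_eq_far (farB_of_not_nearB (List.mem_toFinset.1 hb) (fun h => hnot (List.mem_toFinset.2 h)) U ξ hbox hξ)

/-- ★ **`A` family energy**: the `hver` sum over `[−7,7]³ ∖ 0` equals the sum over `(nearA c w).toFinset`. [folklore] -/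
theorem boxSumA_eq_nearSum {c w : (Fin 3 × Fin 3) ⊕ Fin 3 → ℤ} (U : E3 →L[ℝ] E3)
    (hbox : ∀ ab : Fin 3 × Fin 3, |(U (EuclideanSpace.single ab.2 (1 : ℝ))) ab.1 - (c (Sum.inl ab) : ℝ) / SC| ≤ (w (Sum.inl ab) : ℝ) / SC) :
    ∑ b ∈ (Fintype.piFinset fun _ : Fin 3 => Finset.Icc (-7 : ℤ) 7).filter (fun b => b ≠ 0), effPot w₄₅ ω₄ (3 / 400) ‖latPt U hexFrame b‖ =
      ∑ b ∈ (nearA c w).toFinset, effPot w₄₅ ω₄ (3 / 400) ‖latPt U hexFrame b‖ := by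
  classical
  rw [← boxLabels7_toFinset]
  symm
  refine Finset.sum_subset (fun b hb => ?_) ?_
  · have h := mem_boxLabels7_of_mem_nearA (List.mem_toFinset.1 hb)
    exact Finset.mem_filter.2 ⟨List.mem_toFinset.2 h.1, h.2⟩
  · intro b hb hnot
    obtain ⟨hb7, hb0⟩ := Finset.mem_filter.1 hb
    exact effPot45_eq_far (farA_of_not_nearA (List.mem_toFinset.1 hb7) hb0 (fun h => hnot (List.mem_toFinset.2 h)) U hbox)

end Summit.AtomisticToContinuum.Crystallization.Theorems.FrustratedLawDichotomyStrainedPatchHomValueT2Kit
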